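import Summits.Schanuel.Schanuel.Theorems.ZilberEacGraphResidualSimpleTopRow
import Summits.Schanuel.Schanuel.Theorems.ZilberEacSimpleZeroBranch
import HarnessLib

/-!
# The equimodular class, LII: the residual of Mantova–Masser's question over polynomial graphs
# after gen 25 — `y₀`-degree `3` is gone, and so is every fibre with a simple root of `q₀` or `q_r`

HONEST FRAMING.  Cell `pub-schanuel` (Zilber's Exponential-Algebraic Closedness, case ladder;
host summit Schanuel), seat 2, gen 25.  **`mmCase_graphBase_residual_unramified`**: let
`W ⊆ ℂ² × (ℂˣ)²` be in Mantova–Masser's case over the polynomial graph `x₁ = p(x₀)`, `deg p ≥ 2`, with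
exponential points NOT Zariski dense.  Then, beyond gen 24's residual (file XXXIX:
`W = {x₁ = p(x₀), P₂ = 0}`, `P₂` irreducible and equimodular, and either `P₂ ∈ ℂ[y₀]` or two distinct
positive `y₀`-degrees with an inseparable top row or proportional extreme rows in `y₀`-degree
`r ≥ 3`), the fibre curve now satisfies, with `T` the top row and `q_j = Σ_{v₁ = j} P_v X^{v₀}` the
rows: (B) `T` has NO simple nonzero root, OR every root `a` of `q₀` is a multiple root with
`q₁(a) = 0` and every root `a` of `q_r` is a multiple root with `q_{r-1}(a) = 0` (no simple and no
unramified zero or pole: files XLIV, L, LI); and (A′) the top row is inseparable OR the extreme rows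
are proportional with `r ≥ 4` — the reciprocal-type fibres of `y₀`-degree `3` are ALL dense
(file XLIV).  So over polynomial graphs only (i) constant fibres (not free), (ii) top rows without any
simple nonzero root, or with a multiple root AND a fibre curve all of whose zeros and poles are
multiple-and-ramified, and (iii) reciprocal-type fibres of `y₀`-degree `≥ 4` with `q_r` squareful
(every root multiple) and all zeros/poles ramified remain.  An OPEN question in general
(Mantova–Masser, PLMS 2024 §1 p. 5); EC(3,2) OPEN; NOT Schanuel's conjecture (neither used nor
implied; EAC ⇏ SC).
-/

noncomputable section

open Filter Topology Set Complex MvPolynomial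
open Literature.NumberTheory.Transcendental Literature.ModelTheory.Zilber
open Literature.ModelTheory.ExponentialFields

set_option linter.dupNamespace false

namespace Summit.Schanuel.Schanuel.Theorems

section Residual

variable (p : Polynomial ℂ)

/-- **The residual over polynomial graphs after gen 25 (files XLIV, L, LI).**  See the module docstring.
[cite: MantovaMasser2023, §1 Further remarks, p. 5 (the question, open in general)] (new) -/
theorem mmCase_graphBase_residual_simpleRoots (hd : 2 ≤ p.natDegree)
    {W : Set (Fin 2 ⊕ Fin 2 → ℂ)} (hmm : MMCaseDimPiOneFree W)
    (hbase : zeroLocus ℂ (vanishingIdeal ℂ (projAdd '' (W ∩ torusLocus ℂ 2))) =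
      {x : Fin 2 → ℂ | x 1 = p.eval (x 0)})
    (hnot : ¬ UnprojectedDense W) :
    ∃ P₂ : MvPolynomial (Fin 2) ℂ, Irreducible P₂ ∧
      (∃ v ∈ P₂.support, ∃ v' ∈ P₂.support, v 1 ≠ v' 1) ∧
      W = {w : Fin 2 ⊕ Fin 2 → ℂ | w (Sum.inl 1) = p.eval (w (Sum.inl 0)) ∧
        MvPolynomial.eval ![w (Sum.inl 0), w (Sum.inr 0)] P₂ = 0} ∧
      (p.leadingCoeff * I ^ p.natDegree).re = 0 ∧
      (∀ v₀ ∈ P₂.support, (∀ v ∈ P₂.support, v 0 ≤ v₀ 0) →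
        (∃ vR ∈ P₂.support, vR 0 = v₀ 0 ∧ ∀ u ∈ P₂.support, u 1 ≤ vR 1) ∧
        (∃ vL ∈ P₂.support, vL 0 = v₀ 0 ∧ ∀ u ∈ P₂.support, vL 1 ≤ u 1)) ∧
      (∀ N₀ : ℕ, (∀ v ∈ P₂.support, v 0 ≤ N₀) → ∀ va ∈ P₂.support, ∀ vc ∈ P₂.support,
        va 0 = N₀ → vc 0 = N₀ → va 1 ≠ vc 1 → ∀ θ : ℂ, θ ≠ 0 →
        (∑ v ∈ P₂.support.filter (fun v : Fin 2 →₀ ℕ => v 0 = N₀),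
          Polynomial.C (P₂.coeff v) * Polynomial.X ^ (v 1)).eval θ = 0 →
        (p.natDegree : ℝ) * (p.leadingCoeff * I ^ (p.natDegree - 1)).re * Real.log ‖θ‖ +
          (p.coeff (p.natDegree - 1) * I ^ (p.natDegree - 1)).re = 0) ∧
      (((∃ v ∈ P₂.support, ∃ v' ∈ P₂.support, 0 < v 1 ∧ 0 < v' 1 ∧ v 1 ≠ v' 1) ∧
        ∀ N₀ r : ℕ, (∀ v ∈ P₂.support, v 0 ≤ N₀) → (∃ v ∈ P₂.support, v 0 = N₀) →
          (∀ v ∈ P₂.support, v 1 ≤ r) → (∃ v ∈ P₂.support, v 1 = r) →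
          ((∀ θ : ℂ, θ ≠ 0 →
              (∑ v ∈ P₂.support.filter (fun v : Fin 2 →₀ ℕ => v 0 = N₀),
                Polynomial.C (P₂.coeff v) * Polynomial.X ^ (v 1)).IsRoot θ →
              (Polynomial.derivative (∑ v ∈ P₂.support.filter (fun v : Fin 2 →₀ ℕ => v 0 = N₀),
                Polynomial.C (P₂.coeff v) * Polynomial.X ^ (v 1))).IsRoot θ) ∨
            ((∀ a : ℂ, (∑ v ∈ P₂.support.filter (fun v : Fin 2 →₀ ℕ => v 1 = 0),
                Polynomial.C (P₂.coeff v) * Polynomial.X ^ (v 0)).IsRoot a →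
              (Polynomial.derivative (∑ v ∈ P₂.support.filter (fun v : Fin 2 →₀ ℕ => v 1 = 0),
                Polynomial.C (P₂.coeff v) * Polynomial.X ^ (v 0))).IsRoot a ∧
              (∑ v ∈ P₂.support.filter (fun v : Fin 2 →₀ ℕ => v 1 = 1),
                Polynomial.C (P₂.coeff v) * Polynomial.X ^ (v 0)).IsRoot a) ∧
             (∀ a : ℂ, (∑ v ∈ P₂.support.filter (fun v : Fin 2 →₀ ℕ => v 1 = r),
                Polynomial.C (P₂.coeff v) * Polynomial.X ^ (v 0)).IsRoot a →
              (Polynomial.derivative (∑ v ∈ P₂.support.filter (fun v : Fin 2 →₀ ℕ => v 1 = r),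
                Polynomial.C (P₂.coeff v) * Polynomial.X ^ (v 0))).IsRoot a ∧
              (∑ v ∈ P₂.support.filter (fun v : Fin 2 →₀ ℕ => v 1 = r - 1),
                Polynomial.C (P₂.coeff v) * Polynomial.X ^ (v 0)).IsRoot a))) ∧
          (¬ (∑ v ∈ P₂.support.filter (fun v : Fin 2 →₀ ℕ => v 0 = N₀),
              Polynomial.C (P₂.coeff v) * Polynomial.X ^ (v 1)).Separable ∨
          (4 ≤ r ∧ ∃ c : ℂ,
            (∑ v ∈ P₂.support.filter (fun v : Fin 2 →₀ ℕ => v 1 = 0),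
              Polynomial.C (P₂.coeff v) * Polynomial.X ^ (v 0)) =
            Polynomial.C c * ∑ v ∈ P₂.support.filter (fun v : Fin 2 →₀ ℕ => v 1 = r),
              Polynomial.C (P₂.coeff v) * Polynomial.X ^ (v 0)))) ∨
        (∀ v ∈ P₂.support, v 0 = 0)) := by
  classical
  obtain ⟨P₂, hirr₂, h1, hW₂, hre, hrow, hroot, hdisj⟩ :=
    mmCase_graphBase_residual_simpleTopRow p hd hmm hbase hnot
  refine ⟨P₂, hirr₂, h1, hW₂, hre, hrow, hroot, ?_⟩
  rcases hdisj with ⟨hpos, hold⟩ | hconst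
  swap
  · exact Or.inr hconst
  by_cases hconst : ∀ v ∈ P₂.support, v 0 = 0
  · exact Or.inr hconst
  refine Or.inl ⟨hpos, fun N₀ r hN hNex hr hrex => ?_⟩
  -- the rows
  set Q : Polynomial (Polynomial ℂ) :=
    ∑ v ∈ P₂.support, Polynomial.monomial (v 1) (Polynomial.monomial (v 0) (P₂.coeff v)) with hQ
  set T : Polynomial ℂ := ∑ v ∈ P₂.support.filter (fun v : Fin 2 →₀ ℕ => v 0 = N₀),
    Polynomial.C (P₂.coeff v) * Polynomial.X ^ (v 1) with hTdef
  have hPQ : ∀ x y : ℂ, MvPolynomial.eval ![x, y] P₂ = (Q.map (Polynomial.evalRingHom x)).eval y :=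
    fun x y => eval_eq_rowsPP P₂ x y
  have hNQ : ∀ j, (Q.coeff j).natDegree ≤ N₀ := fun j => natDegree_coeff_rowsPP_le P₂ hN j
  have hQdeg : Q.natDegree = r := natDegree_rowsPP_eq P₂ hr hrex
  have hT : ∀ j, T.coeff j = (Q.coeff j).coeff N₀ := fun j => coeff_topRowSum_eq_coeff_coeff_rowsPP P₂ N₀ j
  have hTcoeff : ∀ j, T.coeff j = P₂.coeff (Finsupp.single 0 N₀ + Finsupp.single 1 j) :=
    fun j => coeff_topRowSum P₂ N₀ j
  have hrowQ : ∀ j, (∑ v ∈ P₂.support.filter (fun v : Fin 2 →₀ ℕ => v 1 = j),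
      Polynomial.C (P₂.coeff v) * Polynomial.X ^ (v 0)) = Q.coeff j := fun j => rowSum_eq_coeff_rowsPP P₂ j
  -- the extreme monomials of the top row
  obtain ⟨v₀, hv₀, hv₀N⟩ := hNex
  obtain ⟨⟨vR, hvR, hvR0, hvRmax⟩, ⟨vL, hvL, hvL0, hvLmin⟩⟩ := hrow v₀ hv₀ (by rw [hv₀N]; exact hN)
  rw [hv₀N] at hvR0 hvL0
  have hvR1 : vR 1 = r := by
    obtain ⟨v, hv, hvr⟩ := hrex
    exact le_antisymm (hr vR hvR) (hvr ▸ hvRmax v hv)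
  obtain ⟨u, hu, hu1⟩ := exists_support_snd_eq_zero_of_irreducible P₂ hirr₂ h1
  have hvL1 : vL 1 = 0 := Nat.le_zero.1 (hu1 ▸ hvLmin u hu)
  have hTr : T.coeff r ≠ 0 := by
    rw [hTcoeff, ← hvR0, ← hvR1, ← Literature.NumberTheory.EllipticCurves.finsupp_fin_two_eq vR]
    exact MvPolynomial.mem_support_iff.1 hvR
  have hT0c : T.coeff 0 ≠ 0 := by
    rw [hTcoeff, ← hvL0, ← hvL1, ← Literature.NumberTheory.EllipticCurves.finsupp_fin_two_eq vL]
    exact MvPolynomial.mem_support_iff.1 hvL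
  have hTdeg : T.natDegree = r := by
    refine le_antisymm ?_ (Polynomial.le_natDegree_of_ne_zero hTr)
    rw [Polynomial.natDegree_le_iff_coeff_eq_zero]
    intro j hj
    rw [hTcoeff]
    refine MvPolynomial.notMem_support_iff.1 fun h => ?_
    have := hr _ h
    simp at this
    have hj' : r < j := by exact_mod_cast hj
    omega
  have hT0 : T ≠ 0 := fun h => hTr (by rw [h, Polynomial.coeff_zero])
  have hT00 : T.eval 0 ≠ 0 := by rwa [← Polynomial.coeff_zero_eq_eval_zero]
  have hN1 : 1 ≤ N₀ := by
    push Not at hconst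
    obtain ⟨v, hv, hv0⟩ := hconst
    have := hN v hv
    omega
  have hQ00 : Q.coeff 0 ≠ 0 := by
    intro h
    apply hT0c
    rw [hT, h, Polynomial.coeff_zero]
  -- the surface
  have hWeq : W = {w : Fin 2 ⊕ Fin 2 → ℂ | w (Sum.inl 1) = p.eval (w (Sum.inl 0)) ∧
      MvPolynomial.eval ![w (Sum.inl 0), w (Sum.inr 0)] P₂ = 0} := hW₂
  -- conjunct (B): a simple nonzero top-row root and an unramified zero or pole give density
  have hB : (∀ θ : ℂ, θ ≠ 0 → T.IsRoot θ → (Polynomial.derivative T).IsRoot θ) ∨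
      ((∀ a : ℂ, (∑ v ∈ P₂.support.filter (fun v : Fin 2 →₀ ℕ => v 1 = 0),
          Polynomial.C (P₂.coeff v) * Polynomial.X ^ (v 0)).IsRoot a →
        (Polynomial.derivative (∑ v ∈ P₂.support.filter (fun v : Fin 2 →₀ ℕ => v 1 = 0),
          Polynomial.C (P₂.coeff v) * Polynomial.X ^ (v 0))).IsRoot a ∧
        (∑ v ∈ P₂.support.filter (fun v : Fin 2 →₀ ℕ => v 1 = 1),
          Polynomial.C (P₂.coeff v) * Polynomial.X ^ (v 0)).IsRoot a) ∧
       (∀ a : ℂ, (∑ v ∈ P₂.support.filter (fun v : Fin 2 →₀ ℕ => v 1 = r),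
          Polynomial.C (P₂.coeff v) * Polynomial.X ^ (v 0)).IsRoot a →
        (Polynomial.derivative (∑ v ∈ P₂.support.filter (fun v : Fin 2 →₀ ℕ => v 1 = r),
          Polynomial.C (P₂.coeff v) * Polynomial.X ^ (v 0))).IsRoot a ∧
        (∑ v ∈ P₂.support.filter (fun v : Fin 2 →₀ ℕ => v 1 = r - 1),
          Polynomial.C (P₂.coeff v) * Polynomial.X ^ (v 0)).IsRoot a)) := by
    rw [hrowQ 0, hrowQ 1, hrowQ r, hrowQ (r - 1)]
    by_contra hneg
    rcases not_or.1 hneg with ⟨hθ, hpts⟩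
    push Not at hθ
    obtain ⟨θ, hθ0, hTθ, hT'θ⟩ := hθ
    apply hnot
    rw [hWeq]
    rcases not_and_or.1 hpts with h0 | hr'
    · push Not at h0
      obtain ⟨a, ha, ha'⟩ := h0
      by_cases hder : (Polynomial.derivative (Q.coeff 0)).IsRoot a
      · exact unprojectedDense_graph_unramifiedBranch Q hPQ hirr₂ N₀ hNQ T hT hT0 hθ0 hTθ hT'θ
          (Or.inl ⟨a, ha, ha' hder⟩) p hd
      · exact unprojectedDense_graph_simpleZero Q hPQ hirr₂ N₀ hNQ T hT hT0 hθ0 hTθ hT'θ ha hder p hd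
    · push Not at hr'
      obtain ⟨a, ha, ha'⟩ := hr'
      rw [← hQdeg] at ha ha'
      by_cases hder : (Polynomial.derivative (Q.coeff Q.natDegree)).IsRoot a
      · exact unprojectedDense_graph_unramifiedBranch Q hPQ hirr₂ N₀ hNQ T hT hT0 hθ0 hTθ hT'θ
          (Or.inr ⟨hQ00, a, ha, ha' hder⟩) p hd
      · exact unprojectedDense_graph_simplePole Q hPQ hirr₂ N₀ hNQ T hT hT0 hθ0 hTθ hT'θ hQ00 ha hder p hd
  -- conjunct (A′): `y₀`-degree `3` with proportional extreme rows is dense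
  have hA : ¬ T.Separable ∨ (4 ≤ r ∧ ∃ c : ℂ,
      (∑ v ∈ P₂.support.filter (fun v : Fin 2 →₀ ℕ => v 1 = 0),
        Polynomial.C (P₂.coeff v) * Polynomial.X ^ (v 0)) =
      Polynomial.C c * ∑ v ∈ P₂.support.filter (fun v : Fin 2 →₀ ℕ => v 1 = r),
        Polynomial.C (P₂.coeff v) * Polynomial.X ^ (v 0)) := by
    rcases hold N₀ r hN ⟨v₀, hv₀, hv₀N⟩ hr hrex with hinsep | ⟨hr3, c, hc⟩
    · exact Or.inl hinsep
    · by_cases hsep : T.Separable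
      · refine Or.inr ⟨?_, c, hc⟩
        by_contra hlt
        have hr3' : r = 3 := by omega
        rw [hrowQ 0, hrowQ r] at hc
        -- a simple nonzero root of `T`
        obtain ⟨θ, hθ⟩ : ∃ θ, T.IsRoot θ := Complex.exists_root (by
          rw [Polynomial.degree_eq_natDegree hT0, hTdeg, hr3']; norm_num)
        have hθ0 : θ ≠ 0 := by rintro rfl; exact hT00 hθ.eq_zero
        have hT'θ : (Polynomial.derivative T).eval θ ≠ 0 := by
          intro hd0
          obtain ⟨u', v', huv⟩ := (Polynomial.separable_def T).1 hsep
          have := congrArg (Polynomial.eval θ) huv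
          rw [Polynomial.eval_add, Polynomial.eval_mul, Polynomial.eval_mul, hθ.eq_zero, hd0, mul_zero, mul_zero,
            add_zero, Polynomial.eval_one] at this
          exact zero_ne_one this
        -- `c ≠ 0` and a root of `q₃`
        have hc0 : c ≠ 0 := by
          rintro rfl
          apply hQ00
          rw [hc, map_zero, zero_mul]
        have hq3deg : 0 < (Q.coeff 3).degree := by
          have hne : Q.coeff 3 ≠ 0 := by
            intro h; apply hTr; rw [hT, hr3', h, Polynomial.coeff_zero]
          have hnat : (Q.coeff 3).natDegree = N₀ := by
            refine le_antisymm (hNQ 3) (Polynomial.le_natDegree_of_ne_zero ?_)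
            rw [← hT, ← hr3']; exact hTr
          rw [Polynomial.degree_eq_natDegree hne, hnat]; exact_mod_cast hN1
        obtain ⟨a, ha⟩ := Complex.exists_root hq3deg
        apply hnot
        rw [hWeq]
        exact unprojectedDense_graph_reciprocalCubic Q hPQ hirr₂ (hQdeg.trans hr3') hc0 (by rw [hc, hr3']) ha
          N₀ hNQ T hT hT0 hθ0 hθ hT'θ p hd
      · exact Or.inl hsep
  exact ⟨hB, hA⟩

end Residual

end Summit.Schanuel.Schanuel.Theorems
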